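import Summits.HodgeConjecture.HodgeConjecture.Theorems.Ring2TransportWeilTypeGeneral
import Summits.HodgeConjecture.HodgeConjecture.Theorems.PadicSemiregularLiftHodgeBeyondAnchorsProductDescent
import Summits.HodgeConjecture.HodgeConjecture.Theses.RankFourFaces
import Summits.HodgeConjecture.HodgeConjecture.Theses.PadicSemiregularLift
import Summits.HodgeConjecture.HodgeConjecture.Statement
import Literature.AlgebraicGeometry.HodgeTheory.WeilClassesSplitSquare
import Literature.AlgebraicGeometry.HodgeTheory.HodgeGroupProductCMFactorClasses
import Literature.AlgebraicGeometry.HodgeTheory.AlgebraicClassesHodgeTypeHolds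
import Literature.AlgebraicGeometry.HodgeTheory.AbelianVarietyPullbackAlgebraicClasses
import Literature.AlgebraicGeometry.HodgeTheory.HodgeFiltrationModelsReductionProofs
import Literature.AlgebraicGeometry.HodgeTheory.ComplexConjugationHolds
import Literature.AlgebraicGeometry.HodgeTheory.LefschetzOneOneHolds
import Literature.AlgebraicGeometry.Motives.AbelianVarietyExistence
import Literature.AlgebraicGeometry.Motives.HyperbolicWeilTypeProduct
import HarnessLib

/-!
# Ring 2 · transport seat (gen 4) — EXACTNESS of the Weil-type class target: "HC for EVERY abelian variety of Weil type" IS "HC for every abelian variety"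

HONEST FRAMING (cell `pub-hodge-ring2`, verbatim): research route conditional on HC_CM; not a corollary;
Q11.4-sentence-2 already refuted in dim ≥ 3.

Seat `transport`, HOME `run/shared/lean/pub/pub-hodge-ring2/`, map `RING2-MAP.md §transport (viii)`. `HC_CM` is the
tree item `Theses.RankFourFaces.CMAbelianHodge` (stmt-HodgeConjecture-3052), ALWAYS an explicit binder, never a cited
fact; `HC_AV` is `Theses.PadicSemiregularLift.HodgeAbelianVarieties` (stmt-HodgeConjecture-1333, text
`∀ A : AbelianVariety ℂ, HodgeConjectureFor A.dim A.X`); `HC_AV_of_HC_CM` is the open item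
`Theses.RankFourFaces.CMToAbelian` (stmt-HodgeConjecture-16267) and is NOT re-filed here.

## What this file settles (gen-3 HANDOFF, owed item (α): "special members of the Weil-type families, dim ≥ 6")

Gens 1–3 of this seat typed the cell's target `HC_WeilType_of_HC_CM` ("`HC_CM` ⇒ HC for abelian varieties of Weil
type") row by row: R∞ (the rational `(n,n)` WEIL CLASSES, `Ring2TransportWeilClasses`), T6 (ALL Hodge classes of the
GENERAL member, `Hg = SU_H`, `Ring2TransportWeilTypeGeneral`), and left the SPECIAL members owed. This file proves —
in the kernel, with NO hypothesis, NO new fact and NO `HC_CM` — that the special members cannot be had short of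
`HC_AV`: for every imaginary quadratic `K = ℚ(√-d)` (`d ≥ 1`) and every `g ≥ 1`, EVERY complex abelian variety `T`
of dimension `g` is a factor of an abelian variety of Weil type `(g, d)`, namely Deligne's split square
`A₀ ⊗ K = (T × T, Φ_d)`, `Φ_d(x, y) = (-d·y, x)` (LNM 900 §4 — held text `book:deligne1982-hodge-cycles-motives-
shimura-varieties`, PDF pages: Lemma 4.5 [p0046 L23] "`A = A₀ ⊗_ℚ E` … `⋀_E^d H¹(A,ℚ)(d/2)` consists of absolute Hodge
cycles"; proof of Thm. 4.8 [p0050 L16 – p0051 L1] "there is also an abelian variety of the form `A₀ ⊗ E` in the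
family", `I₀ ⊗ E` totally isotropic, so the Hermitian space is SPLIT; Remark 4.10 [p0052 L3] algebraic cycles on
`A₀ ⊗ E` from `λ : E → ℚ`; van Geemen LNM 1594, 4.9–4.10 [held text `book:green1994-algebraic-cycles-hodge-theory-
lectures-given-at` p0218 L19, L33] — the eigenvalue condition `t(x) ~ diag(x,…,x,x̄,…,x̄)` that `multiplicity_splitSquare`
verifies. Locator corrected 2026-08-20, referee F-ref2-17: the earlier "van Geemen, proof of Thm. 6.12" was wrong —
that proof [p0232–p0233] is the `SU_H`-invariant count `V_ℂ = W ⊕ W*` and never mentions split squares; 6.11–6.12 are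
cited below ONLY for the general member, `hodgeGeneralWeilType_of_hodgeWeilType`). Its Weil
type is a tree THEOREM in BOTH printed renderings (`weilPlane_splitSquare`: the Weil
plane is of type `(g,g)` — Deligne–Milne Prop. 4.4 — because it is ALGEBRAIC, tree
`weilClassesOf_splitSquare_le_algebraicClasses`; `multiplicity_splitSquare`: van Geemen's 4.9 eigenvalue count
`dim (E_{i√d} ∩ H^{1,0}) = g`, tree `finrank_eq_of_mem_weilClassesOf`), and the Hodge conjecture DESCENDS to factors
(`hodgeConjectureFor_of_prod`: `i_y^* ∘ pr_T^* = id`, Fulton §10.1 — since 2026-08-20 an ALIAS of the landed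
Literature declaration `HodgeTheory.hodgeConjectureFor_left_of_prod`; the general-slice proof for smooth projective
`X ⊗ Y`, via the tree's `exists_sliceAt_map_mem_algebraicClasses'`, is `hodgeConjectureFor_of_tensor_smoothProjective`). "Weil type `(n, d)`" is written INLINE as the five conjuncts of the
tree's `HodgeTheory.isWeilType_iff_weilPlane` (`0 < n`, `0 < d`, `dim A = 2n`, `φ ≫ φ = -d`, Weil plane of type
`(n,n)`), exactly as gen 3's `HodgeGeneralWeilType` does, so that the junction with the statement layer's
`IsWeilType A φ n d` (`Literature/…/WeilTypeAbelianVariety`, p184783) is that single `↔`.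

* `HodgeWeilType` (W∞ inline) and `HodgeWeilTypeColumn d` (ONE field `K = ℚ(√-d)`) — the targets, `@[conjecture] def`s.
* `hodgeAbelianVarieties_iff_hodgeWeilType` — **`HC_AV ↔ HodgeWeilType`**: the class target W∞ is not "strictly between
  R∞ and `HC_AV`" — it IS `HC_AV`.
* `hodgeAbelianVarieties_iff_hodgeWeilTypeColumn` — **`HC_AV ↔ HodgeWeilTypeColumn d`** for every single `d ≥ 1`:
  one imaginary quadratic field already costs everything (`hodgeWeilType_iff_hodgeWeilTypeColumn_one`: `K = ℚ(i)`).
* `hodgeConjectureFor_of_weilSlice_of_dim_le` / `weilSlice_of_forall_dim_eq` — the per-slice SANDWICH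
  `HC_AV(dim = 2n) ⟹ [HC for Weil type (n, d)] ⟹ HC_AV(dim ≤ n)` (`n, d ≥ 1`).
* `cmToAbelian_iff_hodgeWeilType_of_cmAbelianHodge` — **the cell's conditional target `HC_WeilType_of_HC_CM` is
  EQUIVALENT to the open item `CMToAbelian` (stmt-16267)**, `HC_CM` a binder on both sides;
  `cmAbelianHodge_of_hodgeWeilType`: W∞ already CONTAINS `HC_CM`; `hodgeGeneralWeilType_of_hodgeWeilType`: T6 ≤ W∞.

EXACTNESS FOR THE PAPER (numbers, not adjectives): of the three typed readings of "HC for abelian varieties of Weil type"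
— (a) the Weil classes R∞, (b) all Hodge classes of the GENERAL member T6 (= (a) + van Geemen 6.12, gen 3, 1 named
fact), (c) all Hodge classes of ALL members W∞ — reading (c) is `HC_AV` on the nose (this file, 0 hypotheses, 0 facts).
No transport hypothesis weaker than `CMToAbelian` closes `HC_WeilType_of_HC_CM`; owed item (α) is CLOSED AS
`HC_AV`-HARD by a theorem. Every closed conditional theorem of this seat (T1–T7, G1–G6) is about (a) or (b).

NOT claimed (honest column): in print the split squares are of SPLIT Weil type (Deligne, proof of Thm. 4.8: `L ⊗ K`,
`L ⊂ H¹(T, ℚ)` Lagrangian, is totally isotropic; discriminant `(-1)^g`), so in print `HC_SplitWeilType ≡ HC_AV` too; on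
the carriers the hyperbolic frame of `T × T` needs the hyperplane class of a Segre embedding
(`Motives/HyperbolicWeilTypeProduct`, inputs (a)–(c) there) — not in the tree, not attempted. T6 is NOT reached by split
squares (`Hg(T × T) ⊆ Hg(T)` diagonal, `≠ SU_H` for `g ≥ 2`): T6/WΔ remain genuine intermediate classes.

Axioms of every theorem: `propext`, `Classical.choice`, `Quot.sound` (no `sorry`, no named fact; two `@[conjecture]`
targets, each with its on-path lemma).

## References

* [Deligne1982HodgeCycles] P. Deligne (notes by J. Milne), Hodge cycles on abelian varieties, LNM 900 (1982), §4
  Prop. 4.4, Lemma 4.5, Thm. 4.8 (proof), Remark 4.10; §5.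
* [vanGeemen1994HodgeAV] B. van Geemen, An introduction to the Hodge conjecture for abelian varieties, LNM 1594
  (1994), 4.9–4.11, Lemma 5.2, Thm. 6.11–6.12.
* [Fulton1998] W. Fulton, Intersection Theory, 2nd ed. (1998), §10.1, Cor. 10.1, Example 10.1.2.
* [VoisinHodgeI2002] C. Voisin, Hodge Theory and Complex Algebraic Geometry I (2002), §7.3.2, §11.3.
* [Deligne2000] P. Deligne, The Hodge conjecture (Clay, 2000), §1.
* [Markman2025SurveySecant] E. Markman, arXiv:2509.23403 (UNREFEREED survey), §11.5, §12 — statements only.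
-/

set_option linter.dupNamespace false

noncomputable section

open CategoryTheory MonoidalCategory CartesianMonoidalCategory

namespace Summit.HodgeConjecture.HodgeConjecture.Ring2Transport

open Literature.AlgebraicGeometry Literature.AlgebraicGeometry.Motives
open Literature.AlgebraicGeometry.HodgeTheory
open Literature.AlgebraicTopology.SingularHomology
open Summit.HodgeConjecture.HodgeConjecture.Theorems.HodgeBeyondAnchors

/-! ## §0 The targets, inline (junction with `IsWeilType`: `HodgeTheory.isWeilType_iff_weilPlane`) -/

/-- **W∞ — the Hodge conjecture for EVERY complex abelian variety of Weil type** (every `K = ℚ(√-d)`, every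
half-dimension `n`, every discriminant, every member): for `(A, φ, n, d)` with `n, d ≥ 1`, `dim A = 2n`, `φ² = -d` and
Weil plane `weilClassesOf A φ n d` of Hodge type `(n, n)` (⟺ van Geemen's 4.9, Deligne–Milne Prop. 4.4; the tree's
`isWeilType_iff_weilPlane`), `HodgeConjectureFor A.dim A.X`. The statement layer's `HC_WeilType` (RING2-MAP §typer1)
up to that `↔`. By `hodgeAbelianVarieties_iff_hodgeWeilType` below it is EQUIVALENT to `HC_AV`. [cite: vanGeemen1994HodgeAV, 4.9–4.11]
[cite: Deligne1982HodgeCycles, §4 Prop. 4.4] [status: open] -/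
@[conjecture] def HodgeWeilType : Prop :=
  ∀ (A : AbelianVariety ℂ) (φ : A ⟶ A) (n d : ℕ),
    0 < n → 0 < d → A.dim = 2 * n → φ ≫ φ = -(d • 𝟙 A) →
    (∀ c ∈ weilClassesOf A φ n d, IsOfHodgeType (2 * n) A.X (2 * n) n n c) →
    HodgeConjectureFor A.dim A.X

/-- **One column `K = ℚ(√-d)` of W∞**: the Hodge conjecture for every complex abelian variety of Weil type for the
FIXED field `ℚ(φ) ≅ ℚ(√-d)` (all `n`, all discriminants, all members). [cite: vanGeemen1994HodgeAV, 4.9 and 5.3]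
[status: open] -/
@[conjecture] def HodgeWeilTypeColumn (d : ℕ) : Prop :=
  ∀ (A : AbelianVariety ℂ) (φ : A ⟶ A) (n : ℕ),
    0 < n → 0 < d → A.dim = 2 * n → φ ≫ φ = -(d • 𝟙 A) →
    (∀ c ∈ weilClassesOf A φ n d, IsOfHodgeType (2 * n) A.X (2 * n) n n c) →
    HodgeConjectureFor A.dim A.X

/-- W∞ is the conjunction of its columns. [cite: vanGeemen1994HodgeAV, 4.9] -/
theorem hodgeWeilType_iff_forall_column : HodgeWeilType ↔ ∀ d, HodgeWeilTypeColumn d :=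
  ⟨fun h d A φ n ↦ h A φ n d, fun h A φ n d ↦ h d A φ n⟩

/-! ## §1 The Hodge conjecture descends to factors -/

section Descent

variable {n m : ℕ} {X Y : SchemeOver ℂ}

/-- **`HC(X × Y) ⇒ HC(X)`** for smooth projective `X` (dim `n`) and `Y` (dim `m`): a rational `(p,p)`-class `c` on
`X` pulls back to a rational `(p,p)`-class on `X ⊗ Y` (Hodge types do not depend on the model: tree theorem
`hodgePQ_independent_of_hodgeModel_holds`), algebraic by hypothesis; a general slice `i_y^*(pr_X^* c) = c` is
algebraic (tree `exists_sliceAt_map_mem_algebraicClasses'`). The curve case is the tree's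
`HodgeBeyondAnchors.hodgeConjectureFor_of_tensor`. [cite: Fulton1998, §10.1 Cor. 10.1 and Example 10.1.2]
[cite: VoisinHodgeI2002, §11.3] -/
theorem hodgeConjectureFor_of_tensor_smoothProjective (hX : IsSmoothProjective n X) (hY : IsSmoothProjective m Y)
    (h : HodgeConjectureFor (n + m) (X ⊗ Y)) : HodgeConjectureFor n X := by
  obtain ⟨⟨B⟩, hcyc⟩ := h
  have hXY : IsSmoothProjective (n + m) (X ⊗ Y) := Motives.IsSmoothProjective.tensor_holds hX hY
  refine ⟨nonempty_hodgeModel_holds hX, fun p c hc hpp ↦ ?_⟩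
  have hc' : IsRationalClass (complexBetti.map (fst X Y) (2 * p) c) := hc.map _
  have hpp' : IsOfHodgeType (n + m) (X ⊗ Y) (2 * p) p p (complexBetti.map (fst X Y) (2 * p) c) :=
    hpp.map_of_independent hodgePQ_independent_of_hodgeModel_holds hXY hX B (fst X Y)
  have halg := hcyc p _ hc' hpp'
  obtain ⟨y, hy⟩ := exists_sliceAt_map_mem_algebraicClasses' hX hY halg
  rwa [complexBetti_map_sliceAt_map_fst] at hy

end Descent

/-- **`HC(A × B) ⇒ HC(A)`** for complex abelian varieties (`dim (A × B) = dim A + dim B`, `(A × B).X = A.X ⊗ B.X`).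
Revision 2026-08-20: this statement has since LANDED at Literature level as
`Literature.AlgebraicGeometry.HodgeTheory.hodgeConjectureFor_left_of_prod` (`HodgeGroupProductCMFactorClasses`,
slice at the origin + `map_mem_algebraicClasses_of_abelianVariety`); the summit-side name is kept as an ALIAS of that
declaration (same type) because `Ring2ClassTargets`, `Ring2DeformWeilSubpencils` and `Ring2AbelianAllMixedPowers` use
it — one canonical proof, no restatement (gate `dedup.landed`). The general-slice proof for smooth projective
`X ⊗ Y` survives above as `hodgeConjectureFor_of_tensor_smoothProjective`; the abelian case is recovered from it in the
`example` below. [cite: Fulton1998, §10.1 Example 10.1.2] -/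
alias hodgeConjectureFor_of_prod := HodgeTheory.hodgeConjectureFor_left_of_prod

example (A B : AbelianVariety ℂ) (h : HodgeConjectureFor (A.prod B).dim (A.prod B).X) :
    HodgeConjectureFor A.dim A.X := by
  rw [AbelianVariety.dim_prod, AbelianVariety.prod_X] at h
  exact hodgeConjectureFor_of_tensor_smoothProjective
    AbelianVariety.isSmoothProjective_holds AbelianVariety.isSmoothProjective_holds h

/-- **Dimension filtration**: HC for all abelian varieties of dimension EXACTLY `n` gives HC for all of dimension
`≤ n` (pad with an abelian variety of the complementary dimension — powers of an elliptic curve,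
`Motives.exists_abelianVariety_dim_eq_succ` — and descend with `hodgeConjectureFor_of_prod`). [cite: VoisinHodgeI2002, §11.3] -/
theorem forall_dim_le_of_forall_dim_eq {n : ℕ} (h : ∀ A : AbelianVariety ℂ, A.dim = n → HodgeConjectureFor A.dim A.X) :
    ∀ A : AbelianVariety ℂ, A.dim ≤ n → HodgeConjectureFor A.dim A.X := by
  intro A hA
  rcases Nat.eq_or_lt_of_le hA with h' | h'
  · exact h A h'
  · obtain ⟨B, hB⟩ := Motives.exists_abelianVariety_dim_eq_succ ℂ (n - A.dim - 1)
    refine hodgeConjectureFor_of_prod A B (h (A.prod B) ?_)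
    rw [AbelianVariety.dim_prod, hB]
    omega

/-! ## §2 Deligne's split square `(T × T, Φ_d)` is of Weil type `(g, d)` — for EVERY `T`, both renderings -/

section SplitSquare

variable {T : AbelianVariety ℂ} {g d : ℕ}

/-- **Weil-plane rendering (Deligne–Milne Prop. 4.4)**: the Weil plane of `(T × T, Φ_d)` is purely of type `(g, g)`,
for every complex abelian variety `T` of dimension `g ≥ 1` and every `d ≥ 1` — because it consists of ALGEBRAIC classes
(tree `weilClassesOf_splitSquare_le_algebraicClasses`, Deligne's Remark 4.10) and algebraic classes are of type `(g,g)`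
(tree `isOfHodgeType_of_mem_algebraicClasses_of_isSmoothProjective`). The split square `A₀ ⊗ E` and its algebraic Weil
classes are Deligne's Lemma 4.5 [held text p0046 L23], the split member in the proof of Thm. 4.8 [p0050 L16 – p0051 L1]
and Remark 4.10 [p0052 L3]; van Geemen 4.9–4.10 [held text p0218 L19, L33] is the eigenvalue form of the definition
(locator corrected 2026-08-20, referee F-ref2-17: NOT "proof of Thm. 6.12", which is the `SU_H`-invariant count and does
not treat split squares). [cite: Deligne1982HodgeCycles, §4 Lemma 4.5, Prop. 4.4, proof of Thm. 4.8 and Remark 4.10]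
[cite: vanGeemen1994HodgeAV, 4.9–4.10] -/
theorem weilPlane_splitSquare (hg : 0 < g) (hT : T.dim = g) (hd : 0 < d) :
    ∀ c ∈ weilClassesOf (T.prod T)
        (AbelianVariety.prodLift (AbelianVariety.snd T T ≫ (-(d • 𝟙 T))) (AbelianVariety.fst T T)) g d,
      IsOfHodgeType (2 * g) (T.prod T).X (2 * g) g g c :=
  fun _ hc ↦ isOfHodgeType_of_mem_algebraicClasses_of_isSmoothProjective
    (Motives.isSmoothProjective_of_dim_eq' (dim_twistedSquare hT)) g
    (weilClassesOf_splitSquare_le_algebraicClasses hg hT hd hc)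

/-- **Van Geemen 4.9 rendering (second implementation)**: the eigenvalue `i√d` of `Φ_d^*` on `H^{1,0}(T × T)` has
multiplicity EXACTLY `g` — ONE non-zero algebraic class on the `+i√d` eigenline (tree
`exists_mem_weilClassesPlus_splitSquare_algebraic_ne_zero`) forces the balanced count (tree
`finrank_eq_of_mem_weilClassesOf`, Deligne–Milne 4.4 ⇒). This is the field `multiplicity_eq` of the statement layer's
`IsWeilType (T × T) Φ_d g d`. [cite: vanGeemen1994HodgeAV, 4.9 and Lemma 5.2 (6)] [cite: Deligne1982HodgeCycles, §4 Prop. 4.4 and Remark 4.10] -/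
theorem multiplicity_splitSquare (hg : 0 < g) (hT : T.dim = g) (hd : 0 < d) :
    Module.finrank ℂ ↥(Module.End.eigenspace
        (complexBetti.map (AbelianVariety.prodLift (AbelianVariety.snd T T ≫ (-(d • 𝟙 T)))
          (AbelianVariety.fst T T)).hom.hom.hom 1).hom (Complex.I * (Real.sqrt d : ℂ)) ⊓
      hodgeOneZero (Motives.isSmoothProjective_of_dim_eq' (dim_twistedSquare hT))) = g := by
  obtain ⟨P, hP, hPa, hP0⟩ := exists_mem_weilClassesPlus_splitSquare_algebraic_ne_zero hg hT hd
  exact finrank_eq_of_mem_weilClassesOf hg (dim_twistedSquare hT) hd splitSquare_comp_self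
    (weilClassesPlus_le_weilClassesOf _ _ g d hP) hP0
    (isOfHodgeType_of_mem_algebraicClasses_of_isSmoothProjective
      (Motives.isSmoothProjective_of_dim_eq' (dim_twistedSquare hT)) g hPa)

end SplitSquare

/-! ## §3 Exactness: the Weil-type class targets are `HC_AV` -/

/-- **One slice `(K, 2n) = (ℚ(√-d), 2n)` of the Weil-type target gives HC for EVERY abelian variety of dimension `n`**
(`n, d ≥ 1`): apply it to `(T × T, Φ_d)` and descend to the factor `T`. [cite: Deligne1982HodgeCycles, §4 Lemma 4.5 and Remark 4.10]
[cite: Fulton1998, §10.1 Example 10.1.2] -/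
theorem hodgeConjectureFor_of_weilSlice {n d : ℕ} (hn : 0 < n) (hd : 0 < d)
    (h : ∀ (A : AbelianVariety ℂ) (φ : A ⟶ A), A.dim = 2 * n → φ ≫ φ = -(d • 𝟙 A) →
      (∀ c ∈ weilClassesOf A φ n d, IsOfHodgeType (2 * n) A.X (2 * n) n n c) → HodgeConjectureFor A.dim A.X)
    (T : AbelianVariety ℂ) (hT : T.dim = n) : HodgeConjectureFor T.dim T.X :=
  hodgeConjectureFor_of_prod T T (h _ _ (dim_twistedSquare hT) splitSquare_comp_self (weilPlane_splitSquare hn hT hd))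

/-- **… hence for every abelian variety of dimension `≤ n`.** [cite: Deligne1982HodgeCycles, §4 Lemma 4.5 and Remark 4.10]
[cite: VoisinHodgeI2002, §11.3] -/
theorem hodgeConjectureFor_of_weilSlice_of_dim_le {n d : ℕ} (hn : 0 < n) (hd : 0 < d)
    (h : ∀ (A : AbelianVariety ℂ) (φ : A ⟶ A), A.dim = 2 * n → φ ≫ φ = -(d • 𝟙 A) →
      (∀ c ∈ weilClassesOf A φ n d, IsOfHodgeType (2 * n) A.X (2 * n) n n c) → HodgeConjectureFor A.dim A.X) :
    ∀ T : AbelianVariety ℂ, T.dim ≤ n → HodgeConjectureFor T.dim T.X :=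
  forall_dim_le_of_forall_dim_eq fun T hT ↦ hodgeConjectureFor_of_weilSlice hn hd h T hT

/-- The trivial upper bound of the sandwich: HC for all abelian `2n`-folds gives the `(K, 2n)`-slice for every `K`.
[cite: vanGeemen1994HodgeAV, 4.9] -/
theorem weilSlice_of_forall_dim_eq {n : ℕ}
    (h : ∀ A : AbelianVariety ℂ, A.dim = 2 * n → HodgeConjectureFor A.dim A.X) (d : ℕ) :
    ∀ (A : AbelianVariety ℂ) (φ : A ⟶ A), A.dim = 2 * n → φ ≫ φ = -(d • 𝟙 A) →
      (∀ c ∈ weilClassesOf A φ n d, IsOfHodgeType (2 * n) A.X (2 * n) n n c) → HodgeConjectureFor A.dim A.X :=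
  fun A _ hA _ _ ↦ h A hA

/-- **A column gives HC in every positive dimension.** [cite: Deligne1982HodgeCycles, §4 Lemma 4.5 and Remark 4.10] -/
theorem hodgeConjectureFor_of_hodgeWeilTypeColumn {d : ℕ} (hd : 0 < d) (h : HodgeWeilTypeColumn d)
    (T : AbelianVariety ℂ) (hT : 0 < T.dim) : HodgeConjectureFor T.dim T.X :=
  hodgeConjectureFor_of_weilSlice hT hd (fun A φ hA hφ hW ↦ h A φ T.dim hT hd hA hφ hW) T rfl

/-- **ONE column `K = ℚ(√-d)` of the Weil-type target is `HC_AV`** (`d ≥ 1`; dimension `0` by the tree's unconditional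
`hodgeConjectureFor_of_dim_le_three_holds`). [cite: Deligne1982HodgeCycles, §4 Lemma 4.5 and Remark 4.10]
[cite: Fulton1998, §10.1 Example 10.1.2] -/
theorem hodgeAbelianVarieties_of_hodgeWeilTypeColumn {d : ℕ} (hd : 0 < d) (h : HodgeWeilTypeColumn d) :
    Theses.PadicSemiregularLift.HodgeAbelianVarieties := by
  intro T
  rcases Nat.eq_zero_or_pos T.dim with h0 | hpos
  · exact HodgeTheory.hodgeConjectureFor_of_dim_le_three_holds (by omega) AbelianVariety.isSmoothProjective_holds
  · exact hodgeConjectureFor_of_hodgeWeilTypeColumn hd h T hpos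

/-- `HC_AV` gives W∞ (abelian varieties of Weil type are abelian varieties). [cite: vanGeemen1994HodgeAV, 4.9] -/
theorem hodgeWeilType_of_hodgeAbelianVarieties (h : Theses.PadicSemiregularLift.HodgeAbelianVarieties) :
    HodgeWeilType :=
  fun A _ _ _ _ _ _ _ _ ↦ h A

/-- **`HC_AV ↔ HodgeWeilTypeColumn d`** for every single `d ≥ 1`. [cite: Deligne1982HodgeCycles, §4 Lemma 4.5 and Remark 4.10]
[cite: vanGeemen1994HodgeAV, 4.9] -/
theorem hodgeAbelianVarieties_iff_hodgeWeilTypeColumn {d : ℕ} (hd : 0 < d) :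
    Theses.PadicSemiregularLift.HodgeAbelianVarieties ↔ HodgeWeilTypeColumn d :=
  ⟨fun h A _ _ _ _ _ _ _ ↦ h A, hodgeAbelianVarieties_of_hodgeWeilTypeColumn hd⟩

/-- **EXACTNESS OF W∞: `HC_AV ↔ HodgeWeilType`.** The class target "HC for abelian varieties of Weil type, all `K`
quadratic, all `2n`, all discriminants, ALL members" is not a proper intermediate between the Weil-class rung R∞ and
`HC_AV`: it is `HC_AV`. [cite: Deligne1982HodgeCycles, §4 Lemma 4.5 and Remark 4.10] [cite: vanGeemen1994HodgeAV, 4.9 and 4.11] -/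
theorem hodgeAbelianVarieties_iff_hodgeWeilType :
    Theses.PadicSemiregularLift.HodgeAbelianVarieties ↔ HodgeWeilType :=
  ⟨hodgeWeilType_of_hodgeAbelianVarieties,
    fun h ↦ hodgeAbelianVarieties_of_hodgeWeilTypeColumn one_pos (hodgeWeilType_iff_forall_column.1 h 1)⟩

/-- **`K = ℚ(i)` alone**: `HodgeWeilType ↔ HodgeWeilTypeColumn 1`. [cite: Deligne1982HodgeCycles, §4 Lemma 4.5 and Remark 4.10] -/
theorem hodgeWeilType_iff_hodgeWeilTypeColumn_one : HodgeWeilType ↔ HodgeWeilTypeColumn 1 :=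
  ⟨fun h ↦ hodgeWeilType_iff_forall_column.1 h 1,
    fun h ↦ hodgeWeilType_of_hodgeAbelianVarieties (hodgeAbelianVarieties_of_hodgeWeilTypeColumn one_pos h)⟩

/-- Any two columns are equivalent (`d, d' ≥ 1`). [cite: Deligne1982HodgeCycles, §4 Lemma 4.5 and Remark 4.10] -/
theorem hodgeWeilTypeColumn_iff_hodgeWeilTypeColumn {d d' : ℕ} (hd : 0 < d) (hd' : 0 < d') :
    HodgeWeilTypeColumn d ↔ HodgeWeilTypeColumn d' :=
  (hodgeAbelianVarieties_iff_hodgeWeilTypeColumn hd).symm.trans (hodgeAbelianVarieties_iff_hodgeWeilTypeColumn hd')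

/-- **T6 ≤ W∞**: the general-member target of gen 3 (`HodgeGeneralWeilType`, extra hypothesis `HasHodgeGroupSU`) is a
case of W∞ — hence of `HC_AV`; the converse is NOT claimed (split squares are not general members).
[cite: vanGeemen1994HodgeAV, Thm. 6.11–6.12] -/
theorem hodgeGeneralWeilType_of_hodgeWeilType (h : HodgeWeilType) : HodgeGeneralWeilType :=
  fun A φ n d _ _ hn hd hA hφ hW _ _ _ ↦ h A φ n d hn hd hA hφ hW

/-! ## §4 The `HC_CM` column: the conditional target is `CMToAbelian` -/

/-- W∞ already CONTAINS `HC_CM` (`Theses.RankFourFaces.CMAbelianHodge`, stmt-3052): CM abelian varieties are abelian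
varieties. So "`HC_CM ⇒ HC_WeilType`" and "`HC_CM ⇒ HC_AV`" are the same question. [cite: Deligne1982HodgeCycles, §5] -/
theorem cmAbelianHodge_of_hodgeWeilType (h : HodgeWeilType) : Theses.RankFourFaces.CMAbelianHodge :=
  fun A _ _ ↦ hodgeAbelianVarieties_iff_hodgeWeilType.2 h A

/-- **The cell's conditional target `HC_WeilType_of_HC_CM` is EQUIVALENT to the open route item `CMToAbelian`**
(stmt-HodgeConjecture-16267, `HC_CM → ∀ A, IsSmoothProjective A.dim A.X → HodgeConjectureFor A.dim A.X`; the guard is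
discharged by `AbelianVariety.isSmoothProjective_holds`). `HC_CM` is a BINDER on both sides; nothing is assumed.
Consequence: no transport hypothesis strictly weaker than the content of `CMToAbelian` can close
`HC_WeilType_of_HC_CM`. [cite: Deligne1982HodgeCycles, §4 Lemma 4.5 and §5] [cite: Markman2025SurveySecant, §12] -/
theorem cmToAbelian_iff_hodgeWeilType_of_cmAbelianHodge :
    Theses.RankFourFaces.CMToAbelian ↔ (Theses.RankFourFaces.CMAbelianHodge → HodgeWeilType) := by
  constructor
  · intro h hCM
    exact hodgeWeilType_of_hodgeAbelianVarieties fun A ↦ h hCM A AbelianVariety.isSmoothProjective_holds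
  · intro h hCM A _
    exact hodgeAbelianVarieties_iff_hodgeWeilType.2 (h hCM) A

/-- The same with ONE column: `CMToAbelian ↔ (HC_CM → HodgeWeilTypeColumn d)` for every `d ≥ 1`.
[cite: Deligne1982HodgeCycles, §4 Lemma 4.5 and §5] -/
theorem cmToAbelian_iff_hodgeWeilTypeColumn_of_cmAbelianHodge {d : ℕ} (hd : 0 < d) :
    Theses.RankFourFaces.CMToAbelian ↔ (Theses.RankFourFaces.CMAbelianHodge → HodgeWeilTypeColumn d) := by
  rw [cmToAbelian_iff_hodgeWeilType_of_cmAbelianHodge, hodgeAbelianVarieties_iff_hodgeWeilType.symm.trans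
    (hodgeAbelianVarieties_iff_hodgeWeilTypeColumn hd)]

/-- **Kernel form of the cell's row (iii) `HC_AV_of_HC_CM_and_<transportHyp>` with the transport hypothesis "`HC_CM` ⇒
HC on ONE Weil column `K = ℚ(√-d)`"**: `HC_CM` (binder) + that ⟹ `HC_AV`. [cite: Deligne1982HodgeCycles, §4 Lemma 4.5 and §5] -/
theorem hodgeAbelianVarieties_of_cmAbelianHodge_of_weilColumn (hCM : Theses.RankFourFaces.CMAbelianHodge)
    {d : ℕ} (hd : 0 < d) (hcol : Theses.RankFourFaces.CMAbelianHodge → HodgeWeilTypeColumn d) :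
    Theses.PadicSemiregularLift.HodgeAbelianVarieties :=
  hodgeAbelianVarieties_of_hodgeWeilTypeColumn hd (hcol hCM)

/-! ## §5 On-path: every target above is a CASE of the summit -/

/-- ON-PATH: the summit statement gives W∞. [cite: Deligne2000, §1] -/
theorem hodgeWeilType_of_hodgeConjecture (h : _root_.HodgeConjecture) : HodgeWeilType :=
  fun A _ _ _ _ _ _ _ _ ↦ h (show IsSmoothProjective A.dim A.X from AbelianVariety.isSmoothProjective_holds)

/-- ON-PATH: the summit statement gives every column. [cite: Deligne2000, §1] -/
theorem hodgeWeilTypeColumn_of_hodgeConjecture (h : _root_.HodgeConjecture) (d : ℕ) : HodgeWeilTypeColumn d :=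
  fun A _ _ _ _ _ _ _ ↦ h (show IsSmoothProjective A.dim A.X from AbelianVariety.isSmoothProjective_holds)

end Summit.HodgeConjecture.HodgeConjecture.Ring2Transport

end
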